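import Mathlib
import Literature.Computability.AlgebraicComplexity.LocalStrongUSP
import Summits.MatrixMultiplication.MatrixMultiplication.Theses.ThinBlockAlpha
import Summits.MatrixMultiplication.MatrixMultiplication.Theorems.SkewLocalStrongUSP.Negative.PiecesCapAndSandwich

/-!
# MatrixMultiplication / ThinBlockAlpha — `USPToBounded` (stmt-MatrixMultiplication-10600)

Route `ThinBlockAlpha`, support item `USPToBounded : SkewLocalStrongUSP → BoundedExponentThird`
("CKSU Thm 33 at `ℓ = 7` plus counting").

Proof. Fix `ℓ = 7`. Given `η > 0` put `δ := η` and pick `k₀ ≥ 1` with `7k + 1 ≤ (108^η)^k` for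
all `k ≥ k₀` (polynomial versus exponential growth). `SkewLocalStrongUSP` hands us `k ≥ k₀` and a
family `U ⊆ {0,1,2}^{7k}` of rows with `3k` zeros, `k` ones, `3k` twos, satisfying the local
strong USP condition, with `C(7k,k) ≤ 2^{ηk}·|U|`. Index the rows by `Fin |U|` (`Finset.equivFin`);
the condition is verbatim `IsLocalStrongUSP`, so Cohn–Kleinberg–Szegedy–Umans 2005, Thm. 33 (tree
theorem `CohnKleinbergSzegedyUmans2005_thm33_holds`) makes `(A_u, B_u, C_u)_{u ∈ U}` an STPP family
in `H = Cyc₇^{7k}` (exponent `7`). Counting supports, `|A_u| = |C_u| = 6^{3k} =: N`,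
`|B_u| = 6^k = M = N^{1/3}`, and `|H| = 7^{7k} = Σ_j C(7k,j) 6^{7k-j} ≤ (7k+1)·C(7k,k)·6^{6k}`
because the `j = k` term is the largest (ratio test: the terms increase for `j < k` and decrease
for `j ≥ k`). Hence `|H| ≤ (7k+1)·2^{ηk}·|U|·6^{6k} ≤ (108·2)^{ηk}·|U|·6^{6k} = |U|·6^{6k}·(6^{3k})^η
= |U|·N^{2+η}`.

Contents: support counting for the CKSU sets (`card_eq_pow_of_mem_iff_support`, `card_uspA/B/C`),
the binomial-mode estimate (`choose_mul_pow_le_mode`, `seven_pow_le_succ_mul_choose_mul_pow`), the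
growth lemma (`exists_nat_affine_le_pow`), and the closing theorem `uspToBounded_proof`.
-/

noncomputable section

open Finset

namespace Summit.MatrixMultiplication.MatrixMultiplication.Theorems

open Literature.Computability.AlgebraicComplexity

/-! ### Counting the CKSU sets `A_u, B_u, C_u ⊆ Cyc_ℓ^n` -/

/-- Support counting in `Cyc_ℓ^n`: the vectors `x : Fin n → ZMod ℓ` that are nonzero exactly on a
prescribed coordinate set `{j | P j}` number `(ℓ - 1)^{#{j | P j}}` (each prescribed coordinate
ranges over the `ℓ - 1` nonzero residues, the others are `0`). [folklore] -/
theorem card_eq_pow_of_mem_iff_support (ℓ : ℕ) [NeZero ℓ] {n : ℕ} (P : Fin n → Prop)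
    [DecidablePred P] (S : Finset (Fin n → ZMod ℓ)) (hS : ∀ x, x ∈ S ↔ ∀ j, x j ≠ 0 ↔ P j) :
    S.card = (ℓ - 1) ^ (univ.filter P).card := by
  have hset : S = Fintype.piFinset fun j =>
      if P j then univ.filter (fun y : ZMod ℓ => y ≠ 0) else {0} := by
    ext x
    rw [hS, Fintype.mem_piFinset]
    refine forall_congr' fun j => ?_
    by_cases h : P j
    · simp [h]
    · simp [h]
  have hne : (univ.filter fun y : ZMod ℓ => y ≠ 0).card = ℓ - 1 := by
    rw [filter_ne' univ (0 : ZMod ℓ), card_erase_of_mem (mem_univ _), card_univ, ZMod.card]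
  rw [hset, Fintype.card_piFinset]
  simp only [apply_ite Finset.card, hne, card_singleton]
  rw [← Finset.prod_filter, Finset.prod_const]

/-- `|A_u| = (ℓ-1)^{#{j | u_j = 1}}` for the CKSU set `A_u ⊆ Cyc_ℓ^n` (symbol `1` coded `0`).
[cite: CohnKleinbergSzegedyUmans2005, Thm. 33 (p. 10)] -/
theorem card_uspA (ℓ : ℕ) [NeZero ℓ] {n L : ℕ} (row : Fin L → Fin n → Fin 3) (a : Fin L) :
    (uspA ℓ row a).card = (ℓ - 1) ^ (univ.filter fun j => row a j = 0).card :=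
  card_eq_pow_of_mem_iff_support ℓ (fun j => row a j = 0) _ (mem_uspA_iff ℓ row a)

/-- `|B_u| = (ℓ-1)^{#{j | u_j = 2}}` for the CKSU set `B_u ⊆ Cyc_ℓ^n` (symbol `2` coded `1`).
[cite: CohnKleinbergSzegedyUmans2005, Thm. 33 (p. 10)] -/
theorem card_uspB (ℓ : ℕ) [NeZero ℓ] {n L : ℕ} (row : Fin L → Fin n → Fin 3) (a : Fin L) :
    (uspB ℓ row a).card = (ℓ - 1) ^ (univ.filter fun j => row a j = 1).card :=
  card_eq_pow_of_mem_iff_support ℓ (fun j => row a j = 1) _ (mem_uspB_iff ℓ row a)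

/-- `|C_u| = (ℓ-1)^{#{j | u_j = 3}}` for the CKSU set `C_u ⊆ Cyc_ℓ^n` (symbol `3` coded `2`).
[cite: CohnKleinbergSzegedyUmans2005, Thm. 33 (p. 10)] -/
theorem card_uspC (ℓ : ℕ) [NeZero ℓ] {n L : ℕ} (row : Fin L → Fin n → Fin 3) (a : Fin L) :
    (uspC ℓ row a).card = (ℓ - 1) ^ (univ.filter fun j => row a j = 2).card :=
  card_eq_pow_of_mem_iff_support ℓ (fun j => row a j = 2) _ (mem_uspC_iff ℓ row a)

/-! ### The packing count `7^{7k} ≤ (7k+1)·C(7k,k)·6^{6k}` -/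

/-- Ratio test, increasing side: for `j + 1 ≤ k` the binomial term `C(7k,j)·6^{7k-j}` is at most
the next one (since `6(j+1) ≤ 7k-j`). [folklore] -/
theorem choose_mul_pow_step_up (k j : ℕ) (hj : j + 1 ≤ k) :
    Nat.choose (7 * k) j * 6 ^ (7 * k - j) ≤ Nat.choose (7 * k) (j + 1) * 6 ^ (7 * k - (j + 1)) := by
  have h1 : Nat.choose (7 * k) (j + 1) * (j + 1) = Nat.choose (7 * k) j * (7 * k - j) :=
    Nat.choose_succ_right_eq _ _
  have hsub : 7 * k - j = (7 * k - (j + 1)) + 1 := by omega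
  have h2 : Nat.choose (7 * k) j * 6 ≤ Nat.choose (7 * k) (j + 1) := by
    have h3 : Nat.choose (7 * k) j * 6 * (j + 1) ≤ Nat.choose (7 * k) (j + 1) * (j + 1) := by
      rw [h1, mul_assoc]
      exact Nat.mul_le_mul_left _ (by omega)
    exact Nat.le_of_mul_le_mul_right h3 (by omega)
  calc Nat.choose (7 * k) j * 6 ^ (7 * k - j)
      = Nat.choose (7 * k) j * 6 * 6 ^ (7 * k - (j + 1)) := by rw [hsub, pow_succ]; ring
    _ ≤ Nat.choose (7 * k) (j + 1) * 6 ^ (7 * k - (j + 1)) := Nat.mul_le_mul_right _ h2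

/-- Ratio test, decreasing side: for `k ≤ j` the binomial term `C(7k,j+1)·6^{7k-j-1}` is at most
the previous one (since `7k-j ≤ 6(j+1)`). [folklore] -/
theorem choose_mul_pow_step_down (k j : ℕ) (hj : k ≤ j) :
    Nat.choose (7 * k) (j + 1) * 6 ^ (7 * k - (j + 1)) ≤ Nat.choose (7 * k) j * 6 ^ (7 * k - j) := by
  rcases lt_or_ge j (7 * k) with hlt | hle
  · have h1 : Nat.choose (7 * k) (j + 1) * (j + 1) = Nat.choose (7 * k) j * (7 * k - j) :=
      Nat.choose_succ_right_eq _ _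
    have hsub : 7 * k - j = (7 * k - (j + 1)) + 1 := by omega
    have h2 : Nat.choose (7 * k) (j + 1) ≤ Nat.choose (7 * k) j * 6 := by
      have h3 : Nat.choose (7 * k) (j + 1) * (j + 1) ≤ Nat.choose (7 * k) j * 6 * (j + 1) := by
        rw [h1, mul_assoc]
        exact Nat.mul_le_mul_left _ (by omega)
      exact Nat.le_of_mul_le_mul_right h3 (by omega)
    calc Nat.choose (7 * k) (j + 1) * 6 ^ (7 * k - (j + 1))
        ≤ Nat.choose (7 * k) j * 6 * 6 ^ (7 * k - (j + 1)) := Nat.mul_le_mul_right _ h2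
      _ = Nat.choose (7 * k) j * 6 ^ (7 * k - j) := by rw [hsub, pow_succ]; ring
  · rw [Nat.choose_eq_zero_of_lt (by omega : 7 * k < j + 1), zero_mul]
    exact Nat.zero_le _

/-- The binomial terms `C(7k,j)·6^{7k-j}` increase up to `j = k`. [folklore] -/
theorem choose_mul_pow_mono_up (k d : ℕ) : ∀ j : ℕ, j + d ≤ k →
    Nat.choose (7 * k) j * 6 ^ (7 * k - j) ≤ Nat.choose (7 * k) (j + d) * 6 ^ (7 * k - (j + d)) := by
  induction d with
  | zero => intro j _; simp
  | succ d ih =>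
      intro j h
      have ih' := ih (j + 1) (by omega)
      rw [show j + 1 + d = j + (d + 1) by omega] at ih'
      exact (choose_mul_pow_step_up k j (by omega)).trans ih'

/-- The binomial terms `C(7k,j)·6^{7k-j}` decrease from `j = k` on. [folklore] -/
theorem choose_mul_pow_mono_down (k d : ℕ) :
    Nat.choose (7 * k) (k + d) * 6 ^ (7 * k - (k + d)) ≤ Nat.choose (7 * k) k * 6 ^ (7 * k - k) := by
  induction d with
  | zero => simp
  | succ d ih =>
      have h := choose_mul_pow_step_down k (k + d) (by omega)
      rw [show k + d + 1 = k + (d + 1) by omega] at h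
      exact h.trans ih

/-- **Mode of the binomial count.** Every term `C(7k,j)·6^{7k-j}` of the expansion of
`7^{7k} = (1+6)^{7k}` is at most the `j = k` term `C(7k,k)·6^{6k}` (the mode of `Bin(7k, 1/7)`
is `k`). [folklore] -/
theorem choose_mul_pow_le_mode (k j : ℕ) :
    Nat.choose (7 * k) j * 6 ^ (7 * k - j) ≤ Nat.choose (7 * k) k * 6 ^ (6 * k) := by
  have hk : 7 * k - k = 6 * k := by omega
  rcases le_or_gt j k with hjk | hkj
  · have h := choose_mul_pow_mono_up k (k - j) j (by omega)
    rwa [show j + (k - j) = k by omega, hk] at h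
  · have h := choose_mul_pow_mono_down k (j - k)
    rwa [show k + (j - k) = j by omega, hk] at h

/-- **The packing count at `ℓ = 7`:** `7^{7k} ≤ (7k+1)·C(7k,k)·6^{6k}` — the binomial expansion
of `(1+6)^{7k}` has `7k+1` terms, each at most the mode term. [folklore] -/
theorem seven_pow_le_succ_mul_choose_mul_pow (k : ℕ) :
    7 ^ (7 * k) ≤ (7 * k + 1) * (Nat.choose (7 * k) k * 6 ^ (6 * k)) := by
  calc (7 : ℕ) ^ (7 * k) = (1 + 6) ^ (7 * k) := by norm_num
    _ = ∑ m ∈ range (7 * k + 1), 1 ^ m * 6 ^ (7 * k - m) * Nat.choose (7 * k) m :=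
        add_pow 1 6 (7 * k)
    _ ≤ ∑ _m ∈ range (7 * k + 1), Nat.choose (7 * k) k * 6 ^ (6 * k) := by
        refine Finset.sum_le_sum fun m _ => ?_
        rw [one_pow, one_mul, mul_comm]
        exact choose_mul_pow_le_mode k m
    _ = (7 * k + 1) * (Nat.choose (7 * k) k * 6 ^ (6 * k)) := by
        rw [Finset.sum_const, Finset.card_range, smul_eq_mul]

/-! ### Polynomial versus exponential growth -/

/-- For every real `r > 1` the affine function `7k + 1` is eventually dominated by `r^k`.
[folklore] -/
theorem exists_nat_affine_le_pow {r : ℝ} (hr : 1 < r) :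
    ∃ k₀ : ℕ, ∀ k : ℕ, k₀ ≤ k → (7 * k + 1 : ℝ) ≤ r ^ k := by
  have h := tendsto_pow_const_div_const_pow_of_one_lt 1 hr
  have h' : ∀ᶠ n : ℕ in Filter.atTop, (n : ℝ) ^ 1 / r ^ n < 1 / 8 :=
    h.eventually (gt_mem_nhds (by norm_num))
  obtain ⟨N, hN⟩ := Filter.eventually_atTop.1 h'
  refine ⟨max N 1, fun k hk => ?_⟩
  have hkN : N ≤ k := le_trans (le_max_left _ _) hk
  have hk1 : (1 : ℝ) ≤ k := by exact_mod_cast le_trans (le_max_right _ _) hk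
  have hrk : 0 < r ^ k := pow_pos (by linarith) k
  have h1 := hN k hkN
  rw [pow_one, div_lt_iff₀ hrk] at h1
  linarith

/-! ### The support item -/

/-- **`USPToBounded`** (route ThinBlockAlpha, stmt-MatrixMultiplication-10600):
`SkewLocalStrongUSP → BoundedExponentThird`, by Cohn–Kleinberg–Szegedy–Umans 2005, Thm. 33 at
`ℓ = 7` (tree theorem `CohnKleinbergSzegedyUmans2005_thm33_holds`) plus counting: the rows of a
skew local strong USP `U ⊆ {0,1,2}^{7k}` of composition `(3k, k, 3k)` give an STPP family in
`Cyc₇^{7k}` (exponent `7`) with blocks `⟨6^{3k}, 6^k, 6^{3k}⟩`, so `M = N^{1/3}` exactly, and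
`|H| = 7^{7k} ≤ (7k+1)·C(7k,k)·6^{6k} ≤ (7k+1)·2^{ηk}·|U|·6^{6k} ≤ |U|·6^{6k}·(6^{3k})^η` once
`7k + 1 ≤ 108^{ηk}` (take `δ := η` in `SkewLocalStrongUSP`).
[cite: CohnKleinbergSzegedyUmans2005, Thm. 33 (p. 10)] -/
theorem uspToBounded_proof :
    Summit.MatrixMultiplication.MatrixMultiplication.Theses.ThinBlockAlpha.USPToBounded := by
  unfold Summit.MatrixMultiplication.MatrixMultiplication.Theses.ThinBlockAlpha.USPToBounded
  intro hUSP
  refine ⟨7, fun η hη => ?_⟩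
  -- growth constant `r = 108^η > 1`: `(7k+1)·2^{ηk} ≤ (108·2)^{ηk} = (6^{3k})^η` for `k ≥ k₀`
  have hr : (1 : ℝ) < (108 : ℝ) ^ η := Real.one_lt_rpow (by norm_num) hη
  obtain ⟨k₀, hk₀⟩ := exists_nat_affine_le_pow hr
  obtain ⟨k, hk, U, hU1, hU2, hU3⟩ := hUSP η hη (max k₀ 1)
  have hkk₀ : k₀ ≤ k := le_trans (le_max_left _ _) hk
  have hk1 : 1 ≤ k := le_trans (le_max_right _ _) hk
  -- the rows of `U` as a family indexed by `Fin |U|`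
  let row : Fin U.card → Fin (7 * k) → Fin 3 := fun a => ((U.equivFin.symm a : U) : Fin (7 * k) → Fin 3)
  have hmem : ∀ a, row a ∈ U := fun a => (U.equivFin.symm a).2
  have hinj : Function.Injective row :=
    Subtype.val_injective.comp U.equivFin.symm.injective
  have hLS : IsLocalStrongUSP row := by
    intro a b c habc
    have hne : row a ≠ row b ∨ row b ≠ row c :=
      habc.imp (fun h h' => h (hinj h')) (fun h h' => h (hinj h'))
    exact hU1 _ (hmem a) _ (hmem b) _ (hmem c) hne
  have hSTPP : IsSTPP (uspA 7 row) (uspB 7 row) (uspC 7 row) :=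
    CohnKleinbergSzegedyUmans2005_thm33_holds 7 (7 * k) U.card row hLS
  refine ⟨(Fin (7 * k) → ZMod 7), inferInstance, inferInstance, U.card, 6 ^ (3 * k), 6 ^ k,
    uspA 7 row, uspB 7 row, uspC 7 row, ?_, hSTPP, ?_, ?_, ?_, ?_⟩
  · -- the exponent of `Cyc₇^{7k}` divides `7`
    refine Nat.le_of_dvd (by norm_num) (AddMonoid.exponent_dvd_of_forall_nsmul_eq_zero ?_)
    intro x
    funext c
    show (7 : ℕ) • x c = 0
    rw [nsmul_eq_mul, ZMod.natCast_self, zero_mul]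
  · -- block sizes `⟨6^{3k}, 6^k, 6^{3k}⟩`
    intro a
    obtain ⟨h0, h1⟩ := hU2 (row a) (hmem a)
    have h2 := SkewLocalStrongUSP.Negative.card_twoSet (row a) h0 h1
    refine ⟨?_, ?_, ?_⟩
    · rw [card_uspA, h0]
    · rw [card_uspB, h1]
    · rw [card_uspC, h2]
  · -- `2 ≤ 6^{3k}`
    calc (2 : ℕ) ≤ 6 ^ 1 := by norm_num
      _ ≤ 6 ^ (3 * k) := Nat.pow_le_pow_right (by norm_num) (by omega)
  · -- `(6^{3k})^{1/3} = 6^k`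
    push_cast
    have hexp : ((3 * k : ℕ) : ℝ) * (1 / 3 : ℝ) = ((k : ℕ) : ℝ) := by push_cast; ring
    rw [← Real.rpow_natCast (6 : ℝ) (3 * k), ← Real.rpow_mul (by norm_num), hexp,
      Real.rpow_natCast]
  · -- the packing bound `7^{7k} ≤ |U|·(6^{3k})^{2+η}`
    have hcard : Fintype.card (Fin (7 * k) → ZMod 7) = 7 ^ (7 * k) := by
      rw [Fintype.card_fun, ZMod.card, Fintype.card_fin]
    rw [hcard]
    push_cast
    have hA : (7 : ℝ) ^ (7 * k) ≤ (7 * k + 1) * (Nat.choose (7 * k) k * 6 ^ (6 * k)) := by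
      exact_mod_cast seven_pow_le_succ_mul_choose_mul_pow k
    have hB : (Nat.choose (7 * k) k : ℝ) ≤ 2 ^ (η * k) * U.card := hU3
    have hC : (7 * k + 1 : ℝ) ≤ ((108 : ℝ) ^ η) ^ k := hk₀ k hkk₀
    have h6pos : (0 : ℝ) < (6 : ℝ) ^ (3 * k) := by positivity
    have hsplit : ((6 : ℝ) ^ (3 * k)) ^ (2 + η) = (6 : ℝ) ^ (6 * k) * ((6 : ℝ) ^ (3 * k)) ^ η := by
      rw [Real.rpow_add h6pos, Real.rpow_two, ← pow_mul, show 3 * k * 2 = 6 * k by ring]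
    have hkey : ((108 : ℝ) ^ η) ^ k * (2 : ℝ) ^ (η * k) = ((6 : ℝ) ^ (3 * k)) ^ η := by
      rw [← Real.rpow_mul_natCast (by norm_num : (0 : ℝ) ≤ 108),
        ← Real.mul_rpow (by norm_num : (0 : ℝ) ≤ 108) (by norm_num : (0 : ℝ) ≤ 2), pow_mul,
        ← Real.rpow_natCast_mul (by norm_num : (0 : ℝ) ≤ 6 ^ 3) k η, mul_comm (k : ℝ) η]
      norm_num
    calc (7 : ℝ) ^ (7 * k) ≤ (7 * k + 1) * (Nat.choose (7 * k) k * 6 ^ (6 * k)) := hA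
      _ ≤ ((108 : ℝ) ^ η) ^ k * ((2 ^ (η * k) * U.card) * 6 ^ (6 * k)) := by gcongr
      _ = U.card * ((6 : ℝ) ^ (6 * k) * (((108 : ℝ) ^ η) ^ k * (2 : ℝ) ^ (η * k))) := by ring
      _ = U.card * ((6 : ℝ) ^ (3 * k)) ^ (2 + η) := by rw [hkey, hsplit]

end Summit.MatrixMultiplication.MatrixMultiplication.Theorems
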